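import Summits.CriticalPhenomena.PercolationContinuityZ3.Theorems.PercNearOneGluingNoHeavyLowerTailIncStarStrongInduction
import Summits.CriticalPhenomena.PercolationContinuityZ3.Theorems.PercNearOneGluingNoHeavyLowerTailIncStarMarkPairSteps
import HarnessLib

/-!
# The increasing star from ONE inequality along a root pair: the chord through the origin `E₃(G) ≥ p_e · E₃(G/e)`

Support file for the Sahi programme (`--supports stmt-CriticalPhenomena-4575`, prover prim-sahi-p2 gen 30).  No definitions, no named facts, no
sorries; standard axioms.  Memo `run/shared/lean/prim/prim-sahi/FROM-prim-sahi-p2-gen30-VERTEX-INDUCTION-LIGHT-STEP.md` §10, `prim-sahi-p2/PROOF-E3.md` §40.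

Along a root pair `e = s(s,z)` with `p = w e`, Sahi's cubic of the increasing star is a Bernstein cubic `f(p)` with `f(1) = E₃(P_{w[e↦1]})`, the
increasing star of the contraction (`EdgeInduction.sahiE3_oneBond`).  Gen 30's fibre calculus and the root-pair census point at the monotonicity of
`p ↦ f(p)/p` (equivalently `c_k/k` non-increasing for the Bernstein coefficients: `2c₁ ≥ c₂` is census W145's 'P2', 0 / 19.76·10⁹ exceptions;
`3c₂ ≥ 2c₃` is gen 30's R23), whose weakest useful consequence is the CHORD THROUGH THE ORIGIN
   `(CO)   E₃(P_w) ≥ w(e) · E₃(P_{w[e↦1]})`   for fractional root–unmarked pairs `e`.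
Since `E₃(P_{w[e↦1]})` is an increasing star with one fractional pair fewer, (CO) closes the induction by itself.  This file records:

* `incStar_nonneg_of_rootPairStep` — the root-pair induction schema in its most general form: if at every weight with a fractional pair at the root
  hub the increasing star follows from the increasing star for all weights with fewer fractional non-loop pairs (all markings), it holds everywhere
  (gen 4/5's hub-walking: re-root along weight-1 pairs, closed hub ⇒ `E₃ = 0`);
* `incStar_nonneg_of_contractionChord` — **the increasing star on every finite weighted graph from (CO) along fractional root–UNMARKED pairs**
  (root–target pairs are handled by the proved Bernstein step `IncStar.rootTarget_polar_nonneg`).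

Nothing here asserts (CO).
-/

noncomputable section

namespace Summit.CriticalPhenomena.PercolationContinuityZ3.Theorems

namespace IncStar

open MeasureTheory Set Literature.Probability.Percolation Literature.Probability.LatticeModels EdgeInduction
open scoped Classical

variable {n : ℕ}

/-- **ROOT-PAIR INDUCTION SCHEMA (general form).**  If for every weight `w`, all markings `s b c y` and every `v ≠ s` with `s(s,v)` fractional the
increasing star at `s` under `P_w` follows from the increasing star for EVERY weight with strictly fewer fractional non-loop pairs and EVERY marking,
then the increasing star holds on every finite weighted graph on `Fin n`. [this work] -/
theorem incStar_nonneg_of_rootPairStep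
    (h : ∀ (w : Sym2 (Fin n) → unitInterval) (s b c y v : Fin n), v ≠ s → s(s, v) ∈ fracEdges w →
      (∀ w' : Sym2 (Fin n) → unitInterval,
          ((fracEdges w').filter fun f => ¬ f.IsDiag).card < ((fracEdges w).filter fun f => ¬ f.IsDiag).card →
          ∀ s' b' c' y' : Fin n, 0 ≤ sahiE3 (prodBernoulli w') (openConn s' b') (openConn s' c') (openConn s' y')) →
      0 ≤ sahiE3 (prodBernoulli w) (openConn s b) (openConn s c) (openConn s y)) :
    ∀ (w : Sym2 (Fin n) → unitInterval) (s b c y : Fin n),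
      0 ≤ sahiE3 (prodBernoulli w) (openConn s b) (openConn s c) (openConn s y) := by
  suffices H : ∀ (k : ℕ) (w : Sym2 (Fin n) → unitInterval), ((fracEdges w).filter fun e => ¬ e.IsDiag).card ≤ k →
      ∀ s b c y : Fin n, 0 ≤ sahiE3 (prodBernoulli w) (openConn s b) (openConn s c) (openConn s y) from
    fun w s b c y => H _ w le_rfl s b c y
  intro k
  induction k with
  | zero =>
      intro w hk s b c y
      have hnone : ∀ z v : Fin n, z ≠ v → w s(z, v) = 0 ∨ w s(z, v) = 1 := by
        intro z v hzv
        apply eq_zero_or_one_of_not_mem_fracEdges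
        intro hmem
        have : s(z, v) ∈ (fracEdges w).filter fun e => ¬ e.IsDiag := by
          rw [Finset.mem_filter]; exact ⟨hmem, by rwa [Sym2.mk_isDiag_iff]⟩
        have := Finset.card_pos.2 ⟨_, this⟩
        omega
      refine le_of_eq (sahiE3_hub_eq_zero_of_closed w s ?_ b c y).symm
      intro z v hz hv hzv
      rcases hnone z v hzv with h0 | h1
      · exact h0
      · exact absurd (hz.trans (SimpleGraph.Adj.reachable (by
          rw [SimpleGraph.fromEdgeSet_adj]; exact ⟨h1, hzv⟩))) hv
  | succ k ih =>
      intro w hk s b c y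
      by_cases hfr : ∃ z v : Fin n, (SimpleGraph.fromEdgeSet {e : Sym2 (Fin n) | w e = 1}).Reachable s z ∧ z ≠ v ∧ s(z, v) ∈ fracEdges w
      · obtain ⟨z, v, hsz, hzv, he⟩ := hfr
        rw [sahiE3_hub_eq_of_sureReachable w hsz b c y]
        have IH : ∀ w' : Sym2 (Fin n) → unitInterval,
            ((fracEdges w').filter fun f => ¬ f.IsDiag).card < ((fracEdges w).filter fun f => ¬ f.IsDiag).card →
            ∀ s' b' c' y' : Fin n, 0 ≤ sahiE3 (prodBernoulli w') (openConn s' b') (openConn s' c') (openConn s' y') := by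
          intro w' hw' s' b' c' y'
          exact ih w' (by omega) s' b' c' y'
        exact h w z b c y v hzv.symm he IH
      · push Not at hfr
        refine le_of_eq (sahiE3_hub_eq_zero_of_closed w s ?_ b c y).symm
        intro z v hz hv hzv
        rcases eq_zero_or_one_of_not_mem_fracEdges (hfr z v hz hzv) with h0 | h1
        · exact h0
        · exact absurd (hz.trans (SimpleGraph.Adj.reachable (by
            rw [SimpleGraph.fromEdgeSet_adj]; exact ⟨h1, hzv⟩))) hv

/-- **THE INCREASING STAR FROM THE CHORD THROUGH THE ORIGIN (CO).**  Suppose that for every weight `w`, all markings `s b c y` and every unmarked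
`z ∉ {s,b,c,y}` with `e = s(s,z)` fractional — and GIVEN the increasing star for every weight with fewer fractional non-loop pairs and every marking —
`w(e) · E₃(P_{w[e↦1]}) ≤ E₃(P_w)` for the star events at `s`.  Then `E₃({s↔b},{s↔c},{s↔y}) ≥ 0` under `prodBernoulli w` for every weight `w`
on the pairs of `Fin n` and all `s b c y`. [this work] -/
theorem incStar_nonneg_of_contractionChord
    (hCO : ∀ (w : Sym2 (Fin n) → unitInterval) (s b c y z : Fin n), z ≠ s → z ≠ b → z ≠ c → z ≠ y → s(s, z) ∈ fracEdges w →
      (∀ w' : Sym2 (Fin n) → unitInterval,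
          ((fracEdges w').filter fun f => ¬ f.IsDiag).card < ((fracEdges w).filter fun f => ¬ f.IsDiag).card →
          ∀ s' b' c' y' : Fin n, 0 ≤ sahiE3 (prodBernoulli w') (openConn s' b') (openConn s' c') (openConn s' y')) →
      (w s(s, z) : ℝ) * sahiE3 (prodBernoulli (Function.update w s(s, z) 1)) (openConn s b) (openConn s c) (openConn s y) ≤
        sahiE3 (prodBernoulli w) (openConn s b) (openConn s c) (openConn s y)) :
    ∀ (w : Sym2 (Fin n) → unitInterval) (s b c y : Fin n),
      0 ≤ sahiE3 (prodBernoulli w) (openConn s b) (openConn s c) (openConn s y) := by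
  refine incStar_nonneg_of_rootPairStep ?_
  intro w s b c y v hvs he IH
  have hnd : ¬ (s(s, v) : Sym2 (Fin n)).IsDiag := by rw [Sym2.mk_isDiag_iff]; exact hvs.symm
  -- the induction hypothesis at the two corners, same marking
  have h0 : ∀ b' c' y' : Fin n,
      0 ≤ sahiE3 (prodBernoulli (Function.update w s(s, v) 0)) (openConn s b') (openConn s c') (openConn s y') :=
    fun b' c' y' => IH _ (card_fracEdges_update_lt w he hnd 0 (Or.inl rfl)) s b' c' y'
  have h3 : 0 ≤ sahiE3 (prodBernoulli (Function.update w s(s, v) 1)) (openConn s b) (openConn s c) (openConn s y) :=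
    IH _ (card_fracEdges_update_lt w he hnd 1 (Or.inr rfl)) s b c y
  -- root–target pairs: the proved Bernstein step
  by_cases hvb : v = b
  · subst hvb
    obtain ⟨p1, p2⟩ := rootTarget_polar_nonneg w s v c y (Ne.symm hvs) (h0 v c y)
    exact IncStarIrreducible.sahiE3_nonneg_of_bernsteinCoeffs w _ _ _ _ (h0 v c y) p1 p2 h3
  by_cases hvc : v = c
  · subst hvc
    obtain ⟨p1, p2⟩ := rootTarget_polar_nonneg w s v b y (Ne.symm hvs) (h0 v b y)
    refine IncStarIrreducible.sahiE3_nonneg_of_bernsteinCoeffs w _ _ _ _ (h0 b v y) ?_ ?_ h3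
    · rwa [polar₁_comm₁₂]
    · rwa [polar₁_comm₁₂]
  by_cases hvy : v = y
  · subst hvy
    obtain ⟨p1, p2⟩ := rootTarget_polar_nonneg w s v c b (Ne.symm hvs) (h0 v c b)
    refine IncStarIrreducible.sahiE3_nonneg_of_bernsteinCoeffs w _ _ _ _ (h0 b c v) ?_ ?_ h3
    · rw [polar₁_comm₂₃, polar₁_comm₁₂, polar₁_comm₂₃]; exact p1
    · rw [polar₁_comm₂₃, polar₁_comm₁₂, polar₁_comm₂₃]; exact p2
  -- root–unmarked pairs: the chord through the origin
  have hco := hCO w s b c y v hvs hvb hvc hvy he IH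
  have hp0 : (0 : ℝ) ≤ w s(s, v) := (w s(s, v)).2.1
  exact le_trans (mul_nonneg hp0 h3) hco

end IncStar

end Summit.CriticalPhenomena.PercolationContinuityZ3.Theorems

end
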